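import Summits.CriticalPhenomena.Ising3DConformalLimit.Theorems.HarmonicMomentsIsotropyDilutionTransferDefs
import Summits.CriticalPhenomena.Ising3DConformalLimit.Theorems.HarmonicMomentsIsotropyDilutionTransferIsingInputs

/-!
# The scaled two-point measures `ν_β`: probability, lattice-sum formulas, harmonic moments

Support file for item `DilutionTransfer` (stmt-CriticalPhenomena-6037) of route
`HarmonicMomentsIsotropy` (sub-problem `Ising3DConformalLimit`).

* `norm_ofLp_le`, `norm_siteV_sq`, `norm_siteV_le`, `norm_le_norm_siteV` — Euclidean versus sup norm
  of lattice points;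
* `eval_smul_of_isHomogeneous`, `abs_eval_le_of_isHomogeneous` — scaling and growth of homogeneous
  polynomials;
* `isProbabilityMeasure_nu` — `ν_β` is a probability measure for `0 ≤ β < β_c`;
* `integral_nu`, `integrable_nu` — integrals of functions of polynomial growth against `ν_β` are the
  lattice sums `χ⁻¹ ∑ₓ G_β(x) f(x/ξ₂)`;
* `integral_harmonicMoment_eq` — `∫ Y(y)‖y‖^{2m} dν_β = a_{Y,m}(β) ∫ ‖y‖^{n+2m} dν_β` with the
  route's anisotropy ratio `a_{Y,m}` (the link to `HarmonicDilution`).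
-/

noncomputable section

open MeasureTheory Filter Topology Set MvPolynomial
open scoped ENNReal NNReal BigOperators
open Literature.Probability.LatticeModels

namespace Summit.CriticalPhenomena.Ising3DConformalLimit.Theorems.HarmonicMomentsIsotropy

/-! ## Elementary geometry of lattice points in Euclidean `ℝ³` -/

/-- The sup norm of the coordinate vector is bounded by the Euclidean norm (each coordinate is:
`PiLp.norm_apply_le`). -/
theorem norm_ofLp_le (y : V) : ‖(WithLp.ofLp y : Fin 3 → ℝ)‖ ≤ ‖y‖ :=
  (pi_norm_le_iff_of_nonneg (norm_nonneg y)).2 fun i => PiLp.norm_apply_le y i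

/-- `‖siteV x‖² = ∑ᵢ xᵢ²`. -/
theorem norm_siteV_sq (x : Site 3) : ‖siteV x‖ ^ 2 = ∑ i, ((x i : ℤ) : ℝ) ^ 2 := by
  rw [EuclideanSpace.norm_sq_eq]
  congr 1 with i
  simp [siteV_apply]

/-- `‖siteV x‖ = √(∑ᵢ xᵢ²)`. -/
theorem norm_siteV (x : Site 3) : ‖siteV x‖ = Real.sqrt (∑ i, ((x i : ℤ) : ℝ) ^ 2) := by
  rw [← norm_siteV_sq, Real.sqrt_sq (norm_nonneg _)]

/-- The Euclidean norm of a lattice point is at most `√3` times its sup norm; we use the cruder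
`‖siteV x‖ ≤ 3 ‖x‖`. -/
theorem norm_siteV_le (x : Site 3) : ‖siteV x‖ ≤ 3 * ‖x‖ := by
  have h1 : ‖siteV x‖ ^ 2 ≤ (3 * ‖x‖) ^ 2 := by
    rw [norm_siteV_sq]
    have hi : ∀ i : Fin 3, ((x i : ℤ) : ℝ) ^ 2 ≤ ‖x‖ ^ 2 := fun i => by
      have h := norm_le_pi_norm x i
      rw [Int.norm_eq_abs] at h
      calc ((x i : ℤ) : ℝ) ^ 2 = |((x i : ℤ) : ℝ)| ^ 2 := (sq_abs _).symm
        _ ≤ ‖x‖ ^ 2 := pow_le_pow_left₀ (abs_nonneg _) h 2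
    calc ∑ i, ((x i : ℤ) : ℝ) ^ 2 ≤ ∑ _i : Fin 3, ‖x‖ ^ 2 := Finset.sum_le_sum fun i _ => hi i
      _ = 3 * ‖x‖ ^ 2 := by simp
      _ ≤ (3 * ‖x‖) ^ 2 := by nlinarith [norm_nonneg x]
  exact (pow_le_pow_iff_left₀ (norm_nonneg _) (by positivity) two_ne_zero).1 h1

/-- The sup norm of a lattice point is at most its Euclidean norm. -/
theorem norm_le_norm_siteV (x : Site 3) : ‖x‖ ≤ ‖siteV x‖ := by
  rw [pi_norm_le_iff_of_nonneg (norm_nonneg _)]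
  intro i
  rw [Int.norm_eq_abs, ← Int.cast_abs]
  have h := PiLp.norm_apply_le (siteV x) i
  rw [Real.norm_eq_abs] at h
  simpa using h

/-! ## Homogeneous polynomials: scaling and growth -/

/-- A homogeneous polynomial of degree `n` scales like `c^n`: `Y(c v) = cⁿ Y(v)`. -/
theorem eval_smul_of_isHomogeneous {Y : MvPolynomial (Fin 3) ℝ} {n : ℕ} (hY : Y.IsHomogeneous n)
    (c : ℝ) (v : Fin 3 → ℝ) : eval (c • v) Y = c ^ n * eval v Y := by
  conv_lhs => rw [Y.as_sum]
  conv_rhs => rw [Y.as_sum]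
  rw [map_sum, map_sum, Finset.mul_sum]
  refine Finset.sum_congr rfl fun s hs => ?_
  rw [eval_monomial, eval_monomial]
  have hdeg : ∑ i ∈ s.support, s i = n := by
    have h := hY (mem_support_iff.1 hs)
    simp only [Finsupp.weight_apply, Finsupp.sum, Pi.one_apply, smul_eq_mul, mul_one] at h
    exact h
  simp only [Finsupp.prod, Pi.smul_apply, smul_eq_mul, mul_pow, Finset.prod_mul_distrib,
    Finset.prod_pow_eq_pow_sum, hdeg]
  ring

/-- Growth of a homogeneous polynomial of degree `n` (sup norm): `|Y(v)| ≤ C_Y ‖v‖ⁿ`. -/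
theorem abs_eval_le_of_isHomogeneous {Y : MvPolynomial (Fin 3) ℝ} {n : ℕ} (hY : Y.IsHomogeneous n) :
    ∃ C : ℝ, 0 ≤ C ∧ ∀ v : Fin 3 → ℝ, |eval v Y| ≤ C * ‖v‖ ^ n := by
  refine ⟨∑ s ∈ Y.support, |coeff s Y|, Finset.sum_nonneg fun s _ => abs_nonneg _, fun v => ?_⟩
  conv_lhs => rw [Y.as_sum]
  rw [map_sum, Finset.sum_mul]
  refine (Finset.abs_sum_le_sum_abs _ _).trans (Finset.sum_le_sum fun s hs => ?_)
  rw [eval_monomial, abs_mul]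
  refine mul_le_mul_of_nonneg_left ?_ (abs_nonneg _)
  have hdeg : ∑ i ∈ s.support, s i = n := by
    have h := hY (mem_support_iff.1 hs)
    simp only [Finsupp.weight_apply, Finsupp.sum, Pi.one_apply, smul_eq_mul, mul_one] at h
    exact h
  rw [Finsupp.prod, Finset.abs_prod, ← hdeg, ← Finset.prod_pow_eq_pow_sum]
  refine Finset.prod_le_prod (fun i _ => abs_nonneg _) fun i _ => ?_
  rw [abs_pow]
  exact pow_le_pow_left₀ (abs_nonneg _) (by
    have := norm_le_pi_norm v i; rwa [Real.norm_eq_abs] at this) _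

/-- Growth on Euclidean `ℝ³`: `|Y(y)| ≤ C_Y ‖y‖ⁿ` (Euclidean norm). -/
theorem abs_eval_ofLp_le_of_isHomogeneous {Y : MvPolynomial (Fin 3) ℝ} {n : ℕ}
    (hY : Y.IsHomogeneous n) :
    ∃ C : ℝ, 0 ≤ C ∧ ∀ y : V, |eval (fun i => y i) Y| ≤ C * ‖y‖ ^ n := by
  obtain ⟨C, hC, h⟩ := abs_eval_le_of_isHomogeneous hY
  refine ⟨C, hC, fun y => (h (WithLp.ofLp y)).trans ?_⟩
  exact mul_le_mul_of_nonneg_left (pow_le_pow_left₀ (norm_nonneg _) (norm_ofLp_le y) n) hC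

/-- A homogeneous polynomial of degree `n ≥ 1` vanishes at the origin. -/
theorem eval_zero_of_isHomogeneous {Y : MvPolynomial (Fin 3) ℝ} {n : ℕ} (hY : Y.IsHomogeneous n)
    (hn : 1 ≤ n) : eval (0 : Fin 3 → ℝ) Y = 0 := by
  have h := eval_smul_of_isHomogeneous hY 0 0
  rw [zero_smul, zero_pow (by omega), zero_mul] at h
  exact h

/-! ## `ν_β` is a probability measure; integrals against `ν_β` as lattice sums -/

section Good

variable {β : ℝ}

/-- `χ(β) ≥ 1` below `β_c`. -/
theorem one_le_chi (hβ : 0 ≤ β) (hβc : β < criticalBeta 3) : 1 ≤ chi β := IsingInputs.one_le_tsum_G hβ hβc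

/-- `χ(β) > 0` below `β_c`. -/
theorem chi_pos (hβ : 0 ≤ β) (hβc : β < criticalBeta 3) : 0 < chi β :=
  lt_of_lt_of_le one_pos (one_le_chi hβ hβc)

/-- `M₂(β) ≥ 0`. -/
theorem msq_nonneg (hβ : 0 ≤ β) : 0 ≤ msq β :=
  tsum_nonneg fun x => mul_nonneg (Finset.sum_nonneg fun _ _ => sq_nonneg _) (IsingInputs.G_nonneg hβ x)

/-- `ξ₂(β)² = M₂(β)/χ(β)` below `β_c`. -/
theorem xi_sq (hβ : 0 ≤ β) (hβc : β < criticalBeta 3) : xi β ^ 2 = msq β / chi β := by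
  rw [xi, Real.sq_sqrt (div_nonneg (msq_nonneg hβ) (chi_pos hβ hβc).le)]

/-- **`ν_β` is a probability measure** for `0 ≤ β < β_c`. -/
theorem isProbabilityMeasure_nu (hβ : 0 ≤ β) (hβc : β < criticalBeta 3) :
    IsProbabilityMeasure (nu β) := by
  have hχ := chi_pos hβ hβc
  refine isProbabilityMeasure_latMeasure (fun x => div_nonneg (IsingInputs.G_nonneg hβ x) hχ.le)
    ((IsingInputs.summable_G hβ hβc).div_const _) ?_ _
  rw [tsum_div_const, div_eq_one_iff_eq hχ.ne']
  rfl

/-- **Integrals against `ν_β` are lattice sums**: for a measurable `f` of polynomial growth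
(`|f(y)| ≤ A‖y‖^q + B`), `∫ f dν_β = χ(β)⁻¹ ∑ₓ G_β(x) f(x/ξ₂(β))`. -/
theorem integral_nu (hβ : 0 ≤ β) (hβc : β < criticalBeta 3) {f : V → ℝ} (hf : Measurable f)
    {A B : ℝ} {q : ℕ} (hbd : ∀ y, |f y| ≤ A * ‖y‖ ^ q + B) :
    ∫ y, f y ∂(nu β) = (chi β)⁻¹ * ∑' x : Site 3, twoPointFree 3 β x * f ((xi β)⁻¹ • siteV x) := by
  have hχ := chi_pos hβ hβc
  rw [nu, integral_latMeasure (fun x => div_nonneg (IsingInputs.G_nonneg hβ x) hχ.le) _ hf]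
  · rw [← tsum_mul_left]
    refine tsum_congr fun x => ?_
    rw [div_eq_inv_mul]; ring
  · -- absolute summability from polynomial growth
    have hξ : 0 ≤ (xi β)⁻¹ := inv_nonneg.2 (xi_nonneg β)
    have hw : ∀ x : Site 3, |(|f ((xi β)⁻¹ • siteV x)|)| ≤
        |A| * ((xi β)⁻¹ * 3) ^ q * ‖x‖ ^ q + |B| := by
      intro x
      rw [abs_abs]
      refine (hbd _).trans ?_
      have hn : ‖(xi β)⁻¹ • siteV x‖ ≤ (xi β)⁻¹ * 3 * ‖x‖ := by
        rw [norm_smul, Real.norm_eq_abs, abs_of_nonneg hξ, mul_assoc]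
        exact mul_le_mul_of_nonneg_left (norm_siteV_le x) hξ
      calc A * ‖(xi β)⁻¹ • siteV x‖ ^ q + B ≤ |A| * ‖(xi β)⁻¹ • siteV x‖ ^ q + |B| := by
            gcongr
            · exact le_abs_self A
            · exact le_abs_self B
        _ ≤ |A| * ((xi β)⁻¹ * 3 * ‖x‖) ^ q + |B| := by gcongr
        _ = |A| * ((xi β)⁻¹ * 3) ^ q * ‖x‖ ^ q + |B| := by rw [mul_pow]; ring
    have h := IsingInputs.summable_weight_mul_G hβ hβc hw
    refine (h.div_const (chi β)).congr fun x => ?_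
    rw [abs_abs]
    ring

/-- Integrability against `ν_β` of measurable functions of polynomial growth. -/
theorem integrable_nu (hβ : 0 ≤ β) (hβc : β < criticalBeta 3) {f : V → ℝ} (hf : Measurable f)
    {A B : ℝ} {q : ℕ} (hbd : ∀ y, |f y| ≤ A * ‖y‖ ^ q + B) : Integrable f (nu β) := by
  have hχ := chi_pos hβ hβc
  refine integrable_latMeasure (fun x => div_nonneg (IsingInputs.G_nonneg hβ x) hχ.le) _ hf ?_
  have hξ : 0 ≤ (xi β)⁻¹ := inv_nonneg.2 (xi_nonneg β)
  have hw : ∀ x : Site 3, |(|f ((xi β)⁻¹ • siteV x)|)| ≤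
      |A| * ((xi β)⁻¹ * 3) ^ q * ‖x‖ ^ q + |B| := by
    intro x
    rw [abs_abs]
    refine (hbd _).trans ?_
    have hn : ‖(xi β)⁻¹ • siteV x‖ ≤ (xi β)⁻¹ * 3 * ‖x‖ := by
      rw [norm_smul, Real.norm_eq_abs, abs_of_nonneg hξ, mul_assoc]
      exact mul_le_mul_of_nonneg_left (norm_siteV_le x) hξ
    calc A * ‖(xi β)⁻¹ • siteV x‖ ^ q + B ≤ |A| * ‖(xi β)⁻¹ • siteV x‖ ^ q + |B| := by
          gcongr
          · exact le_abs_self A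
          · exact le_abs_self B
      _ ≤ |A| * ((xi β)⁻¹ * 3 * ‖x‖) ^ q + |B| := by gcongr
      _ = |A| * ((xi β)⁻¹ * 3) ^ q * ‖x‖ ^ q + |B| := by rw [mul_pow]; ring
  have h := IsingInputs.summable_weight_mul_G hβ hβc hw
  refine (h.div_const (chi β)).congr fun x => ?_
  rw [abs_abs]
  ring

/-- **Harmonic moments of `ν_β` are anisotropy ratios times radial moments.** For `Y` homogeneous of
degree `n ≥ 1` and `m ≥ 0`, with `q = n + 2m`,
`∫ Y(y)‖y‖^{2m} dν_β = a_{Y,m}(β) · ∫ ‖y‖^q dν_β`, where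
`a_{Y,m}(β) = ∑ₓ Y(x)|x|^{2m}G_β(x) / ∑ₓ |x|^q G_β(x)` is the route's anisotropy ratio (for
`0 < β < β_c`; `|x| = √(∑xᵢ²)`). -/
theorem integral_harmonicMoment_eq (hβ : 0 ≤ β) (hβc : β < criticalBeta 3)
    {Y : MvPolynomial (Fin 3) ℝ} {n : ℕ} (hn : 1 ≤ n) (hY : Y.IsHomogeneous n) (m : ℕ) :
    ∫ y, eval (fun i => y i) Y * ‖y‖ ^ (2 * m) ∂(nu β) =
      ((∑' x : Site 3, eval (fun i => ((x i : ℤ) : ℝ)) Y *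
          Real.sqrt (∑ i, ((x i : ℤ) : ℝ) ^ 2) ^ (2 * m) * twoPointFree 3 β x) /
        (∑' x : Site 3, Real.sqrt (∑ i, ((x i : ℤ) : ℝ) ^ 2) ^ (n + 2 * m) * twoPointFree 3 β x)) *
      ∫ y, ‖y‖ ^ (n + 2 * m) ∂(nu β) := by
  have hχ := chi_pos hβ hβc
  obtain ⟨CY, hCY0, hCY⟩ := abs_eval_ofLp_le_of_isHomogeneous hY
  -- the two integrals as lattice sums
  have hmeasY : Measurable fun y : V => eval (fun i => y i) Y * ‖y‖ ^ (2 * m) := by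
    refine Measurable.mul ?_ (continuous_norm.measurable.pow_const _)
    exact (continuous_eval Y |>.comp (by fun_prop : Continuous fun y : V => fun i => y i)).measurable
  have hbdY : ∀ y : V, |eval (fun i => y i) Y * ‖y‖ ^ (2 * m)| ≤ CY * ‖y‖ ^ (n + 2 * m) + 0 := by
    intro y
    rw [abs_mul, abs_of_nonneg (by positivity : (0 : ℝ) ≤ ‖y‖ ^ (2 * m)), add_zero, pow_add,
      ← mul_assoc]
    exact mul_le_mul_of_nonneg_right (hCY y) (by positivity)
  have hmeasR : Measurable fun y : V => ‖y‖ ^ (n + 2 * m) := continuous_norm.measurable.pow_const _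
  have hbdR : ∀ y : V, |‖y‖ ^ (n + 2 * m)| ≤ 1 * ‖y‖ ^ (n + 2 * m) + 0 := fun y => by
    rw [abs_of_nonneg (by positivity)]; simp
  rw [integral_nu hβ hβc hmeasY hbdY, integral_nu hβ hβc hmeasR hbdR]
  -- homogeneity: pull out `ξ⁻ᵠ`
  set t : ℝ := (xi β)⁻¹ with ht
  have ht0 : 0 ≤ t := inv_nonneg.2 (xi_nonneg β)
  have hscaleY : ∀ x : Site 3, eval (fun i => (t • siteV x) i) Y * ‖t • siteV x‖ ^ (2 * m) =
      t ^ (n + 2 * m) * (eval (fun i => ((x i : ℤ) : ℝ)) Y *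
        Real.sqrt (∑ i, ((x i : ℤ) : ℝ) ^ 2) ^ (2 * m)) := by
    intro x
    have h1 : (fun i => (t • siteV x) i) = t • fun i => ((x i : ℤ) : ℝ) := by
      funext i; simp [siteV_apply]
    rw [h1, eval_smul_of_isHomogeneous hY, norm_smul, Real.norm_eq_abs, abs_of_nonneg ht0, mul_pow,
      norm_siteV, pow_add]
    ring
  have hscaleR : ∀ x : Site 3, ‖t • siteV x‖ ^ (n + 2 * m) =
      t ^ (n + 2 * m) * Real.sqrt (∑ i, ((x i : ℤ) : ℝ) ^ 2) ^ (n + 2 * m) := by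
    intro x
    rw [norm_smul, Real.norm_eq_abs, abs_of_nonneg ht0, mul_pow, norm_siteV]
  simp_rw [hscaleY, hscaleR]
  have hk : ∑' x : Site 3, twoPointFree 3 β x * (t ^ (n + 2 * m) *
      (eval (fun i => ((x i : ℤ) : ℝ)) Y * Real.sqrt (∑ i, ((x i : ℤ) : ℝ) ^ 2) ^ (2 * m))) =
      t ^ (n + 2 * m) * ∑' x : Site 3, eval (fun i => ((x i : ℤ) : ℝ)) Y *
        Real.sqrt (∑ i, ((x i : ℤ) : ℝ) ^ 2) ^ (2 * m) * twoPointFree 3 β x := by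
    rw [← tsum_mul_left]; exact tsum_congr fun x => by ring
  have hM : ∑' x : Site 3, twoPointFree 3 β x * (t ^ (n + 2 * m) *
      Real.sqrt (∑ i, ((x i : ℤ) : ℝ) ^ 2) ^ (n + 2 * m)) =
      t ^ (n + 2 * m) * ∑' x : Site 3, Real.sqrt (∑ i, ((x i : ℤ) : ℝ) ^ 2) ^ (n + 2 * m) *
        twoPointFree 3 β x := by
    rw [← tsum_mul_left]; exact tsum_congr fun x => by ring
  rw [hk, hM]
  set K : ℝ := ∑' x : Site 3, eval (fun i => ((x i : ℤ) : ℝ)) Y *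
    Real.sqrt (∑ i, ((x i : ℤ) : ℝ) ^ 2) ^ (2 * m) * twoPointFree 3 β x with hK
  set M : ℝ := ∑' x : Site 3, Real.sqrt (∑ i, ((x i : ℤ) : ℝ) ^ 2) ^ (n + 2 * m) *
    twoPointFree 3 β x with hMdef
  by_cases hM0 : M = 0
  · -- degenerate case: `M = 0` forces `K = 0`
    have hsumM : Summable fun x : Site 3 => Real.sqrt (∑ i, ((x i : ℤ) : ℝ) ^ 2) ^ (n + 2 * m) *
        twoPointFree 3 β x := by
      refine IsingInputs.summable_weight_mul_G' hβ hβc (A := 3 ^ (n + 2 * m)) (B := 0) (q := n + 2 * m)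
        fun x => ?_
      rw [abs_of_nonneg (by positivity), add_zero, ← norm_siteV, ← mul_pow]
      exact pow_le_pow_left₀ (norm_nonneg _) (norm_siteV_le x) _
    have hzero : ∀ x : Site 3, Real.sqrt (∑ i, ((x i : ℤ) : ℝ) ^ 2) ^ (n + 2 * m) *
        twoPointFree 3 β x = 0 := by
      have hnn : ∀ x : Site 3, 0 ≤ Real.sqrt (∑ i, ((x i : ℤ) : ℝ) ^ 2) ^ (n + 2 * m) *
          twoPointFree 3 β x := fun x => mul_nonneg (by positivity) (IsingInputs.G_nonneg hβ x)
      have h := (hasSum_zero_iff_of_nonneg hnn).1 (by rw [← hM0]; exact hsumM.hasSum)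
      exact fun x => congrFun h x
    have hK0 : K = 0 := by
      rw [hK]
      refine (tsum_congr fun x => ?_).trans tsum_zero
      by_cases hx : x = 0
      · subst hx
        have : (fun i => (((0 : Site 3) i : ℤ) : ℝ)) = 0 := by funext i; simp
        rw [this, eval_zero_of_isHomogeneous hY hn]; ring
      · have hpos : 0 < Real.sqrt (∑ i, ((x i : ℤ) : ℝ) ^ 2) := by
          rw [← norm_siteV, norm_pos_iff]
          exact fun h => hx (siteV_injective (by rw [h]; ext i; simp))
        have hG : twoPointFree 3 β x = 0 := by
          have := hzero x
          rcases mul_eq_zero.1 this with h | h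
          · exact absurd h (pow_ne_zero _ hpos.ne')
          · exact h
        rw [hG]; ring
    rw [hM0, hK0]; simp
  · field_simp

end Good

end Summit.CriticalPhenomena.Ising3DConformalLimit.Theorems.HarmonicMomentsIsotropy

end
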